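import Mathlib.Analysis.Calculus.Taylor
import Mathlib.Analysis.Calculus.ContDiff.Basic

/-!
# `Balaban1983to89.B12Taylor334` — [Balaban1987RG1] (3.33)–(3.34) p. 277: the fifth-order expansion of
`𝐄^{(j)}(X, U_j(□₀, exp iB))` in `B` with the integral form of the remainder ("the fundamental expansion for the
analysis of renormalization")

HONEST FRAMING (cell `lit-balaban`, verbatim): statement-level skeleton of published theorems with citation tags;
proofs where landed; nothing here is a claim about the Yang–Mills mass gap.

CITATION HEADER.  T. Bałaban, *Renormalization group approach to lattice gauge field theories. I. Generation of
effective actions in a small field approximation and a coupling constant renormalization in four dimensions*,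
Commun. Math. Phys. **109** (1987) 249–301, doi:10.1007/bf01215223 [Balaban1987RG1] (cell paper B12; held text
`paper:balaban1987-cmp109-rg-i-small-field`, journal page = PDF page + 248; the displays were read from the page
render `b2b-balaban-ref1/pages/1987-cmp109-rg-I-small-field/…-p029-x2.png`).  Unit `lit-balaban-r09`, SKELETON row
`B12.Eq3.33-3.34`.

WHAT IS PRINTED (p. 277 [PDF 29], verbatim): *«Thus we consider the function
  𝐄^{(j)}(X, U_j(□₀, exp iQ(ηA))) = 𝐄^{(j)}(X, U_j(□₀, exp iB)),   (3.33)
and we expand it in B up to the fifth order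
  𝐄^{(j)}(X, U_j(□₀, exp iB)) = Σ_{n=0}^{4} (1/n!) ⟨(δⁿ/δBⁿ) 𝐄^{(j)}(X, U_j(□₀, 1)), ⊗ⁿ B⟩
      + ∫₀¹ dτ ((1 − τ)⁴/4!) ⟨(δ⁵/δB⁵) 𝐄^{(j)}(X, U_j(□₀, exp iτB)), ⊗⁵ B⟩.   (3.34)
This is the fundamental expansion for the analysis of renormalization.»*  The functions are analytic on the space
(3.36) (p. 277: "The analyticity of the functions in (3.34) follows from the analyticity of the two functions in
(3.36), and the assumed analyticity of 𝐄^{(j)}(X, 𝐔, 𝐉)").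

WHAT THIS MODULE PROVES: (3.34) is the order-4 Taylor formula with INTEGRAL remainder for the map
`B ↦ f B := 𝐄^{(j)}(X, U_j(□₀, exp iB))` along the ray `τ ↦ τB`, the n-th variational derivative paired with `⊗ⁿ B`
being the n-th Fréchet derivative evaluated on `(B, …, B)`.  We prove it for an arbitrary map `f : E → F` between
real normed spaces (`F` complete) that is `C⁵` on an open set containing the segment `{τB : τ ∈ [0,1]}` — exactly
the regularity the paper uses (analyticity on the domain (3.36) ⊇ the segment, p. 277) — from Mathlib's
one-variable `taylor_integral_remainder` and the chain rule along the ray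
(`ContinuousLinearMap.iteratedFDerivWithin_comp_right`).  The one-variable form is `taylor5_integral_remainder`;
the printed multilinear form is `taylor334` (the ray is Mathlib's `ContinuousLinearMap.toSpanSingleton ℝ B`).  No carriers of the cell are needed and nothing is assumed.
-/

namespace Literature.MathematicalPhysics.QuantumFieldTheory.Balaban1983to89.B12Taylor334

open Set
open scoped Nat

variable {E F : Type*} [NormedAddCommGroup E] [NormedSpace ℝ E] [NormedAddCommGroup F] [NormedSpace ℝ F]
  [CompleteSpace F]

/-- One-variable form of (3.34): for `g : ℝ → F` of class `C⁵` on `[0, 1]`,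
`g(1) = Σ_{n=0}^{4} (1/n!) g⁽ⁿ⁾(0) + ∫₀¹ ((1 − τ)⁴/4!) g⁽⁵⁾(τ) dτ` (derivatives within `[0, 1]`).
[cite: Balaban1987RG1, (3.34) p.277] -/
theorem taylor5_integral_remainder {g : ℝ → F} (hg : ContDiffOn ℝ 5 g (Icc (0 : ℝ) 1)) :
    g 1 = ∑ n ∈ Finset.range 5, ((n ! : ℝ)⁻¹) • iteratedDerivWithin n g (Icc 0 1) 0
      + ∫ τ in (0 : ℝ)..1, ((1 - τ) ^ 4 / (4 ! : ℝ)) • iteratedDerivWithin 5 g (Icc 0 1) τ := by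
  have hI : uIcc (0 : ℝ) 1 = Icc 0 1 := uIcc_of_le zero_le_one
  have h := taylor_integral_remainder (f := g) (x₀ := (0 : ℝ)) (x := 1) (n := 4) (by
    rw [hI]; exact_mod_cast hg)
  rw [hI, taylor_within_apply] at h
  simp only [sub_zero, one_pow, mul_one] at h
  rw [← h]
  abel

omit [CompleteSpace F] in
/-- Chain rule along the ray: for `f` of class `C⁵` on an open set `s` and `τB ∈ s`, the `n`-th derivative
(`n ≤ 5`) of `τ ↦ f(τB)` at `τ` is the `n`-th Fréchet derivative of `f` at `τB` evaluated on `(B, …, B)` — the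
pairing `⟨δⁿf/δBⁿ, ⊗ⁿ B⟩` of (3.34). [cite: Balaban1987RG1, (3.34) p.277] -/
theorem iteratedDeriv_comp_ray {s : Set E} (hs : IsOpen s) {f : E → F} (hf : ContDiffOn ℝ 5 f s) (B : E)
    {τ : ℝ} (hτ : τ • B ∈ s) {n : ℕ} (hn : n ≤ 5) :
    iteratedDeriv n (fun t : ℝ => f (t • B)) τ = iteratedFDeriv ℝ n f (τ • B) (fun _ => B) := by
  have hs' : IsOpen ((ContinuousLinearMap.toSpanSingleton ℝ B) ⁻¹' s) := hs.preimage (ContinuousLinearMap.toSpanSingleton ℝ B).continuous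
  have hτ' : τ ∈ (ContinuousLinearMap.toSpanSingleton ℝ B) ⁻¹' s := by simpa using hτ
  have hcomp : (fun t : ℝ => f (t • B)) = f ∘ (ContinuousLinearMap.toSpanSingleton ℝ B) := by
    funext t; simp
  rw [iteratedDeriv_eq_iteratedFDeriv, hcomp, ← iteratedFDerivWithin_of_isOpen n hs' hτ',
    (ContinuousLinearMap.toSpanSingleton ℝ B).iteratedFDerivWithin_comp_right hf hs.uniqueDiffOn hs'.uniqueDiffOn (x := τ) (by simpa using hτ)
      (i := n) (by exact_mod_cast hn),
    ContinuousMultilinearMap.compContinuousLinearMap_apply]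
  simp only [ContinuousLinearMap.toSpanSingleton_apply, one_smul]
  exact congrArg (fun m : ContinuousMultilinearMap ℝ (fun _ : Fin n => E) F => m (fun _ => B))
    (iteratedFDerivWithin_of_isOpen (𝕜 := ℝ) (f := f) n hs hτ)

/-- **(3.34)** p. 277, the fundamental expansion: for a map `f : E → F` (`F` complete) of class `C⁵` on an open set
`s ⊆ E` containing the segment `{τB : 0 ≤ τ ≤ 1}`,
`f(B) = Σ_{n=0}^{4} (1/n!) ⟨Dⁿf(0), ⊗ⁿ B⟩ + ∫₀¹ dτ ((1 − τ)⁴/4!) ⟨D⁵f(τB), ⊗⁵ B⟩`.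
In the paper `f(B) = 𝐄^{(j)}(X, U_j(□₀, exp iB))` ((3.33)), analytic on the domain (3.36) ⊇ the segment.
[cite: Balaban1987RG1, (3.33)–(3.34) p.277] -/
theorem taylor334 {s : Set E} (hs : IsOpen s) {f : E → F} (hf : ContDiffOn ℝ 5 f s) (B : E)
    (hB : ∀ τ ∈ Icc (0 : ℝ) 1, τ • B ∈ s) :
    f B = ∑ n ∈ Finset.range 5, ((n ! : ℝ)⁻¹) • iteratedFDeriv ℝ n f 0 (fun _ => B)
      + ∫ τ in (0 : ℝ)..1, ((1 - τ) ^ 4 / (4 ! : ℝ)) • iteratedFDeriv ℝ 5 f (τ • B) (fun _ => B) := by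
  -- the line function `g(τ) = f(τB)` is `C⁵` on the open set `ray⁻¹ s ⊇ [0, 1]`
  set g : ℝ → F := fun t => f (t • B) with hg_def
  have hs' : IsOpen ((ContinuousLinearMap.toSpanSingleton ℝ B) ⁻¹' s) := hs.preimage (ContinuousLinearMap.toSpanSingleton ℝ B).continuous
  have hsub : Icc (0 : ℝ) 1 ⊆ (ContinuousLinearMap.toSpanSingleton ℝ B) ⁻¹' s := fun τ hτ => by simpa using hB τ hτ
  have hg' : ContDiffOn ℝ 5 g ((ContinuousLinearMap.toSpanSingleton ℝ B) ⁻¹' s) := by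
    have : g = f ∘ (ContinuousLinearMap.toSpanSingleton ℝ B) := by funext t; simp [hg_def]
    rw [this]
    exact hf.comp (ContinuousLinearMap.toSpanSingleton ℝ B).contDiff.contDiffOn (fun x hx => hx)
  have hg : ContDiffOn ℝ 5 g (Icc (0 : ℝ) 1) := hg'.mono hsub
  -- derivatives within `[0, 1]` are the free derivatives, and those are the multilinear pairings
  have hkey : ∀ τ ∈ Icc (0 : ℝ) 1, ∀ n ≤ 5,
      iteratedDerivWithin n g (Icc 0 1) τ = iteratedFDeriv ℝ n f (τ • B) (fun _ => B) := by
    intro τ hτ n hn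
    have hτ' : τ ∈ (ContinuousLinearMap.toSpanSingleton ℝ B) ⁻¹' s := hsub hτ
    have hat : ContDiffAt ℝ 5 g τ := hg'.contDiffAt (hs'.mem_nhds hτ')
    rw [iteratedDerivWithin_eq_iteratedDeriv (uniqueDiffOn_Icc zero_lt_one)
      (hat.of_le (by exact_mod_cast hn)) hτ]
    exact iteratedDeriv_comp_ray hs hf B (by simpa using hτ') hn
  have h1 := taylor5_integral_remainder hg
  have hg1 : g 1 = f B := by simp [hg_def]
  rw [hg1] at h1
  rw [h1]
  congr 1
  · refine Finset.sum_congr rfl fun n hn => ?_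
    have hn5 : n ≤ 5 := by
      have := Finset.mem_range.mp hn; omega
    rw [hkey 0 ⟨le_rfl, zero_le_one⟩ n hn5, zero_smul]
  · refine intervalIntegral.integral_congr fun τ hτ => ?_
    rw [uIcc_of_le zero_le_one] at hτ
    simp only [hkey τ hτ 5 le_rfl]

end Literature.MathematicalPhysics.QuantumFieldTheory.Balaban1983to89.B12Taylor334
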